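import Mathlib
import HarnessLib
import Literature.MathematicalPhysics.QuantumFieldTheory.U1WardIdentity
import Summits.QuantumFields.YangMills.Theorems.U1DipoleHelicityBogoliubov

/-!
# The `U(1)` Ward identity and the lattice Bogoliubov inequality for REAL test 1-forms

Route-independent infrastructure (no `Theses` import) for the parity-free lower half of the crux
stmt-QuantumFields-25881 `Theses.U1DipoleHelicity.WilsonU1PlaquetteSecondMomentD4` of the abelian
comparison line `U1DipoleHelicity` (LINE 4 of the ideator cell ym-idea-2; not a rung of `YangMills`).

The tree's Ward identity `u1_torus_ward_identity` (`U1WardIdentity.lean`) is stated for INTEGER edge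
charges `c : Edge d L → ℤ`; its proof (Haar invariance under the phase flow `θ_e ↦ θ_e + c_e t`,
differentiation under the integral sign) uses integrality nowhere.  The optimal test form of the
lattice Bogoliubov inequality (`U1DipoleHelicityBogoliubov.lean`) — built from the torus Green function —
is real-valued, so this file records the real-charge copies:

* `rexpConfig`, `rphaseFlow`, `rplaqCharge`, `ractionFlowDeriv` — verbatim real analogues of
  `expConfig`, `phaseFlow`, `plaqCharge`, `actionFlowDeriv`;
* `u1_torus_ward_identity_real` — `⟨XF⟩_β = β⟨F · X_cS⟩_β` for `c : Edge d L → ℝ`;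
* `sq_rplaqCharge_mul_le` — **the lattice Bogoliubov inequality for real test forms**:
  `(n_p⟨cos θ_p⟩)² ≤ β⟨sin²θ_p⟩ · Σ_q n_q²⟨cos θ_q⟩`, `n = dc`.

Nothing here bears on the Yang–Mills mass gap.
-/

noncomputable section

namespace Summit.QuantumFields.YangMills.Theorems.U1DipoleHelicity

open MeasureTheory Filter Topology Finset
open Literature.MathematicalPhysics.QuantumLattice Literature.MathematicalPhysics.QuantumFieldTheory

variable {d L : ℕ}

/-! ### Real phase flows -/

/-- The pure-phase configuration `e ↦ e^{i c(e) t}` of a REAL edge charge `c`. [folklore] -/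
def rexpConfig (c : Edge d L → ℝ) (t : ℝ) : GaugeConfig d L Circle := fun e => Circle.exp (c e * t)

/-- The phase flow `U ↦ (e ↦ e^{i c(e) t} U_e)` of a real edge charge. [folklore] -/
def rphaseFlow (c : Edge d L → ℝ) (t : ℝ) (U : GaugeConfig d L Circle) : GaugeConfig d L Circle :=
  rexpConfig c t * U

/-- The real plaquette charge `(dc)_{(x;i,j)} = c(x,i) + c(x+eᵢ,j) − c(x+eⱼ,i) − c(x,j)`. [folklore] -/
def rplaqCharge (c : Edge d L → ℝ) (x : Site d L) (i j : Fin d) : ℝ :=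
  c (x, i) + c (x.shift i, j) - c (x.shift j, i) - c (x, j)

/-- The derivative of the `U(1)` Wilson action along the real flow, `X_c S = Σ_p (dc)_p Im U_p`.
[folklore] -/
def ractionFlowDeriv [NeZero L] (c : Edge d L → ℝ) (U : GaugeConfig d L Circle) : ℝ :=
  ∑ p : Plaquette d L,
    rplaqCharge c p.1 p.2.1.1 p.2.1.2 * ((plaquetteHolonomy U p.1 p.2.1.1 p.2.1.2 : Circle) : ℂ).im

/-- The real flow at time `0` is the identity. [folklore] -/
@[simp] theorem rphaseFlow_zero (c : Edge d L → ℝ) (U : GaugeConfig d L Circle) : rphaseFlow c 0 U = U := by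
  funext e; simp [rphaseFlow, rexpConfig]

/-- The flow is continuous in the configuration. [folklore] -/
theorem continuous_rphaseFlow (c : Edge d L → ℝ) (t : ℝ) : Continuous (rphaseFlow c t) :=
  continuous_const.mul continuous_id

/-- The plaquette holonomy of the real pure-phase configuration. [folklore] -/
theorem plaquetteHolonomy_rexpConfig (c : Edge d L → ℝ) (t : ℝ) (x : Site d L) (i j : Fin d) :
    plaquetteHolonomy (rexpConfig c t) x i j = Circle.exp (rplaqCharge c x i j * t) := by
  simp only [plaquetteHolonomy, rexpConfig, rplaqCharge, ← Circle.exp_neg, ← Circle.exp_add]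
  congr 1
  ring

/-- Plaquette holonomies rotate under the real flow by their charge. [folklore] -/
theorem plaquetteHolonomy_rphaseFlow (c : Edge d L → ℝ) (t : ℝ) (U : GaugeConfig d L Circle)
    (x : Site d L) (i j : Fin d) :
    plaquetteHolonomy (rphaseFlow c t U) x i j =
      Circle.exp (rplaqCharge c x i j * t) * plaquetteHolonomy U x i j := by
  rw [rphaseFlow, ← plaquetteHolonomy_rexpConfig]
  exact (u1PlaqChar x i j).map_mul _ _

/-- The derivative of the Wilson action along the real flow. [folklore] -/
theorem hasDerivAt_wilsonAction_rphaseFlow [NeZero L] (c : Edge d L → ℝ) (U : GaugeConfig d L Circle)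
    (t : ℝ) :
    HasDerivAt (fun s => wilsonAction u1Rep (rphaseFlow c s U)) (ractionFlowDeriv c (rphaseFlow c t U)) t := by
  simp only [wilsonAction_u1_eq, ractionFlowDeriv, plaquetteHolonomy_rphaseFlow]
  refine HasDerivAt.fun_sum fun p _ => ?_
  have h := hasDerivAt_coe_exp_mul_re (rplaqCharge c p.1 p.2.1.1 p.2.1.2)
    (plaquetteHolonomy U p.1 p.2.1.1 p.2.1.2) t
  refine (h.const_sub 1).congr_deriv ?_
  ring

/-- The action derivative is continuous. [folklore] -/
theorem continuous_ractionFlowDeriv [NeZero L] (c : Edge d L → ℝ) :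
    Continuous (ractionFlowDeriv (d := d) (L := L) c) := by
  unfold ractionFlowDeriv
  refine continuous_finsetSum _ fun p _ => continuous_const.mul ?_
  exact Complex.continuous_im.comp (continuous_subtype_val.comp (u1PlaqChar p.1 p.2.1.1 p.2.1.2).continuous)

section Torus

variable [NeZero L]

/-- Haar measure is invariant under the real phase flow. [folklore] -/
theorem integral_comp_rphaseFlow (c : Edge d L → ℝ) (t : ℝ) (H : GaugeConfig d L Circle → ℝ) :
    ∫ U, H (rphaseFlow c t U) ∂(Measure.pi fun _ : Edge d L => haarProbability Circle) =
      ∫ U, H U ∂(Measure.pi fun _ : Edge d L => haarProbability Circle) :=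
  integral_mul_left_eq_self H (rexpConfig c t)

/-- Haar integration by parts along a real phase flow: `∫ H' dHaar = 0`. [folklore] -/
theorem integral_rflowDeriv_eq_zero (c : Edge d L → ℝ) {H H' : GaugeConfig d L Circle → ℝ}
    (hH : Continuous H) (hH' : Continuous H')
    (hderiv : ∀ U t, HasDerivAt (fun s => H (rphaseFlow c s U)) (H' (rphaseFlow c t U)) t) :
    ∫ U, H' U ∂(Measure.pi fun _ : Edge d L => haarProbability Circle) = 0 := by
  obtain ⟨M, hM⟩ := exists_bound_of_continuous_torus hH'
  have key := hasDerivAt_integral_of_dominated_loc_of_deriv_le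
    (μ := Measure.pi fun _ : Edge d L => haarProbability Circle)
    (F := fun t U => H (rphaseFlow c t U)) (F' := fun t U => H' (rphaseFlow c t U)) (x₀ := (0 : ℝ))
    (bound := fun _ => M) (s := Set.univ) Filter.univ_mem
    (Filter.Eventually.of_forall fun t =>
      (hH.comp (continuous_rphaseFlow c t)).aestronglyMeasurable)
    (integrable_u1TorusHaar_of_continuous (hH.comp (continuous_rphaseFlow c 0)))
    ((hH'.comp (continuous_rphaseFlow c 0)).aestronglyMeasurable)
    (ae_of_all _ fun U t _ => hM _) (integrable_const M)
    (ae_of_all _ fun U t _ => hderiv U t)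
  have h2 : HasDerivAt (fun t : ℝ => ∫ U, H (rphaseFlow c t U)
      ∂(Measure.pi fun _ : Edge d L => haarProbability Circle)) 0 0 := by
    simp_rw [integral_comp_rphaseFlow]
    exact hasDerivAt_const _ _
  have h3 := key.2.unique h2
  simpa using h3

/-- **The `U(1)` Ward identity on a finite torus for a REAL charge vector** `c`:
`⟨XF⟩_β = β ⟨F · X_c S⟩_β` whenever `t ↦ F(φ_t U)` has derivative `XF(φ_t U)` (`F`, `XF` continuous).
[folklore] -/
theorem u1_torus_ward_identity_real (c : Edge d L → ℝ) (β : ℝ) {F XF : GaugeConfig d L Circle → ℝ}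
    (hF : Continuous F) (hXF : Continuous XF)
    (hderiv : ∀ U t, HasDerivAt (fun s => F (rphaseFlow c s U)) (XF (rphaseFlow c t U)) t) :
    wilsonExpectation u1Rep β XF =
      β * wilsonExpectation u1Rep β (fun U => F U * ractionFlowDeriv c U) := by
  have hSc : Continuous fun U : GaugeConfig d L Circle => wilsonAction u1Rep U :=
    continuous_wilsonAction u1Rep continuous_u1Rep
  have hXS := continuous_ractionFlowDeriv (d := d) (L := L) c
  have hwc : Continuous fun U : GaugeConfig d L Circle => Real.exp (-β * wilsonAction u1Rep U) :=
    Real.continuous_exp.comp (continuous_const.mul hSc)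
  have hHc : Continuous fun U : GaugeConfig d L Circle =>
      F U * Real.exp (-β * wilsonAction u1Rep U) := hF.mul hwc
  have hH'c : Continuous fun U : GaugeConfig d L Circle =>
      XF U * Real.exp (-β * wilsonAction u1Rep U) +
        F U * (Real.exp (-β * wilsonAction u1Rep U) * (-β * ractionFlowDeriv c U)) :=
    (hXF.mul hwc).add (hF.mul (hwc.mul (continuous_const.mul hXS)))
  have hder : ∀ U t, HasDerivAt
      (fun s => F (rphaseFlow c s U) * Real.exp (-β * wilsonAction u1Rep (rphaseFlow c s U)))
      (XF (rphaseFlow c t U) * Real.exp (-β * wilsonAction u1Rep (rphaseFlow c t U)) +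
        F (rphaseFlow c t U) * (Real.exp (-β * wilsonAction u1Rep (rphaseFlow c t U)) *
          (-β * ractionFlowDeriv c (rphaseFlow c t U)))) t := fun U t =>
    (hderiv U t).mul ((hasDerivAt_wilsonAction_rphaseFlow c U t).const_mul (-β)).exp
  have h0 := integral_rflowDeriv_eq_zero c
    (H := fun U => F U * Real.exp (-β * wilsonAction u1Rep U))
    (H' := fun U => XF U * Real.exp (-β * wilsonAction u1Rep U) +
      F U * (Real.exp (-β * wilsonAction u1Rep U) * (-β * ractionFlowDeriv c U))) hHc hH'c hder
  have hi1 : Integrable (fun U => XF U * Real.exp (-β * wilsonAction u1Rep U))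
      (Measure.pi fun _ : Edge d L => haarProbability Circle) :=
    integrable_u1TorusHaar_of_continuous (hXF.mul hwc)
  have hi2 : Integrable
      (fun U => F U * (Real.exp (-β * wilsonAction u1Rep U) * (-β * ractionFlowDeriv c U)))
      (Measure.pi fun _ : Edge d L => haarProbability Circle) :=
    integrable_u1TorusHaar_of_continuous (hF.mul (hwc.mul (continuous_const.mul hXS)))
  have h0' : ∫ U, XF U * Real.exp (-β * wilsonAction u1Rep U)
        ∂(Measure.pi fun _ : Edge d L => haarProbability Circle) +
      ∫ U, F U * (Real.exp (-β * wilsonAction u1Rep U) * (-β * ractionFlowDeriv c U))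
        ∂(Measure.pi fun _ : Edge d L => haarProbability Circle) = 0 := by
    rw [← integral_add hi1 hi2]
    exact h0
  have h3 : ∫ U, F U * (Real.exp (-β * wilsonAction u1Rep U) * (-β * ractionFlowDeriv c U))
        ∂(Measure.pi fun _ : Edge d L => haarProbability Circle) =
      -β * ∫ U, F U * ractionFlowDeriv c U * Real.exp (-β * wilsonAction u1Rep U)
        ∂(Measure.pi fun _ : Edge d L => haarProbability Circle) := by
    rw [← integral_const_mul]
    refine integral_congr_ae (ae_of_all _ fun U => ?_)
    ring
  rw [h3] at h0'
  have h4 : ∫ U, XF U * Real.exp (-β * wilsonAction u1Rep U)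
        ∂(Measure.pi fun _ : Edge d L => haarProbability Circle) =
      β * ∫ U, F U * ractionFlowDeriv c U * Real.exp (-β * wilsonAction u1Rep U)
        ∂(Measure.pi fun _ : Edge d L => haarProbability Circle) := by linarith
  rw [wilsonExpectation_eq_div_integral u1Rep continuous_u1Rep,
    wilsonExpectation_eq_div_integral u1Rep continuous_u1Rep]
  rw [h4, mul_div_assoc]

/-! ### The lattice Bogoliubov inequality for real test forms -/

/-- Ward identity for one plaquette sine, real charge: `n_p⟨cos θ_p⟩ = β⟨sin θ_p · X_cS⟩`. [folklore] -/
theorem ward_plaquette_im_real (c : Edge d L → ℝ) (β : ℝ) (x : Site d L) (i j : Fin d) :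
    wilsonExpectation u1Rep β (fun U : GaugeConfig d L Circle =>
        rplaqCharge c x i j * ((plaquetteHolonomy U x i j : Circle) : ℂ).re) =
      β * wilsonExpectation u1Rep β (fun U : GaugeConfig d L Circle =>
        ((plaquetteHolonomy U x i j : Circle) : ℂ).im * ractionFlowDeriv c U) := by
  refine u1_torus_ward_identity_real c β (continuous_plaquette_im x i j)
    (continuous_const.mul (continuous_plaquette_re x i j)) fun U t => ?_
  simp only [plaquetteHolonomy_rphaseFlow]
  exact hasDerivAt_coe_exp_mul_im _ _ _

/-- Ward identity for the real action derivative: `Σ_q n_q²⟨cos θ_q⟩ = β⟨(X_cS)²⟩`. [folklore] -/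
theorem ward_ractionFlowDeriv (c : Edge d L → ℝ) (β : ℝ) :
    wilsonExpectation u1Rep β (fun U : GaugeConfig d L Circle => ∑ q : Plaquette d L,
        rplaqCharge c q.1 q.2.1.1 q.2.1.2 ^ 2 *
          ((plaquetteHolonomy U q.1 q.2.1.1 q.2.1.2 : Circle) : ℂ).re) =
      β * wilsonExpectation u1Rep β (fun U : GaugeConfig d L Circle =>
        ractionFlowDeriv c U * ractionFlowDeriv c U) := by
  refine u1_torus_ward_identity_real c β (continuous_ractionFlowDeriv c)
    (continuous_finsetSum _ fun q _ => continuous_const.mul (continuous_plaquette_re _ _ _))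
    fun U t => ?_
  simp only [ractionFlowDeriv, plaquetteHolonomy_rphaseFlow]
  refine HasDerivAt.fun_sum fun q _ => ?_
  have h := (hasDerivAt_coe_exp_mul_im (rplaqCharge c q.1 q.2.1.1 q.2.1.2)
    (plaquetteHolonomy U q.1 q.2.1.1 q.2.1.2) t).const_mul (rplaqCharge c q.1 q.2.1.1 q.2.1.2)
  refine h.congr_deriv ?_
  ring

/-- **The lattice Bogoliubov inequality for a REAL test 1-form** `c` on a torus, Wilson `U(1)`, any `β`,
any plaquette `p = (x; i, j)`: `(n_p⟨cos θ_p⟩)² ≤ β⟨sin²θ_p⟩ · Σ_q n_q²⟨cos θ_q⟩` (`n = dc`). [folklore] -/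
theorem sq_rplaqCharge_mul_le (c : Edge d L → ℝ) (β : ℝ) (x : Site d L) (i j : Fin d) :
    (rplaqCharge c x i j * wilsonExpectation u1Rep β
        (fun U : GaugeConfig d L Circle => ((plaquetteHolonomy U x i j : Circle) : ℂ).re)) ^ 2 ≤
      β * wilsonExpectation u1Rep β
          (fun U : GaugeConfig d L Circle => ((plaquetteHolonomy U x i j : Circle) : ℂ).im ^ 2) *
        wilsonExpectation u1Rep β (fun U : GaugeConfig d L Circle => ∑ q : Plaquette d L,
          rplaqCharge c q.1 q.2.1.1 q.2.1.2 ^ 2 *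
            ((plaquetteHolonomy U q.1 q.2.1.1 q.2.1.2 : Circle) : ℂ).re) := by
  have h1 := ward_plaquette_im_real c β x i j
  have h2 := ward_ractionFlowDeriv c β
  have hn : rplaqCharge c x i j * wilsonExpectation u1Rep β
      (fun U : GaugeConfig d L Circle => ((plaquetteHolonomy U x i j : Circle) : ℂ).re) =
      wilsonExpectation u1Rep β (fun U : GaugeConfig d L Circle =>
        rplaqCharge c x i j * ((plaquetteHolonomy U x i j : Circle) : ℂ).re) := by
    simp only [wilsonExpectation]
    rw [integral_const_mul]
  have hCS := sq_integral_mul_le (wilsonMeasure (d := d) (L := L) u1Rep β)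
    (X := fun U : GaugeConfig d L Circle => ((plaquetteHolonomy U x i j : Circle) : ℂ).im)
    (A := ractionFlowDeriv c)
    (integrable_wilson_of_continuous β ((continuous_plaquette_im x i j).mul (continuous_ractionFlowDeriv c)))
    (integrable_wilson_of_continuous β ((continuous_plaquette_im x i j).pow 2))
    (integrable_wilson_of_continuous β ((continuous_ractionFlowDeriv c).pow 2))
  rw [hn, h1, h2]
  simp only [wilsonExpectation] at hCS ⊢
  have hsq : ∫ U, ractionFlowDeriv c U * ractionFlowDeriv c U ∂wilsonMeasure u1Rep β =
      ∫ U, ractionFlowDeriv c U ^ 2 ∂wilsonMeasure u1Rep β := by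
    refine integral_congr_ae (ae_of_all _ fun U => ?_); simp only [sq]
  rw [hsq]
  have hβ : 0 ≤ β ^ 2 := sq_nonneg β
  calc (β * ∫ U, ((plaquetteHolonomy U x i j : Circle) : ℂ).im * ractionFlowDeriv c U
          ∂wilsonMeasure u1Rep β) ^ 2
      = β ^ 2 * (∫ U, ((plaquetteHolonomy U x i j : Circle) : ℂ).im * ractionFlowDeriv c U
          ∂wilsonMeasure u1Rep β) ^ 2 := by ring
    _ ≤ β ^ 2 * ((∫ U, ((plaquetteHolonomy U x i j : Circle) : ℂ).im ^ 2 ∂wilsonMeasure u1Rep β) *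
          ∫ U, ractionFlowDeriv c U ^ 2 ∂wilsonMeasure u1Rep β) :=
        mul_le_mul_of_nonneg_left hCS hβ
    _ = β * (∫ U, ((plaquetteHolonomy U x i j : Circle) : ℂ).im ^ 2 ∂wilsonMeasure u1Rep β) *
          (β * ∫ U, ractionFlowDeriv c U ^ 2 ∂wilsonMeasure u1Rep β) := by ring

/-- **Corollary: the Bogoliubov bound with a uniform mean cosine.** If every plaquette has the same
mean cosine `m` (true on the torus, `wilsonExpectation_plaquette_re_eq`), then for every real test form
`c` and `β ≥ 0`: `m² n_p² ≤ β⟨sin²θ_p⟩ · m · Σ_q n_q²`, i.e. (for `m > 0`)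
`β⟨sin²θ_p⟩ ≥ m · n_p²/‖dc‖²`. [folklore] -/
theorem sq_rplaqCharge_mul_le_sum_sq (c : Edge d L → ℝ) (β : ℝ) (x : Site d L) {i j : Fin d}
    (hij : i ≠ j) :
    (rplaqCharge c x i j) ^ 2 * (wilsonExpectation u1Rep β
        (fun U : GaugeConfig d L Circle => ((plaquetteHolonomy U x i j : Circle) : ℂ).re)) ^ 2 ≤
      β * wilsonExpectation u1Rep β
          (fun U : GaugeConfig d L Circle => ((plaquetteHolonomy U x i j : Circle) : ℂ).im ^ 2) *
        ((∑ q : Plaquette d L, rplaqCharge c q.1 q.2.1.1 q.2.1.2 ^ 2) *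
          wilsonExpectation u1Rep β
            (fun U : GaugeConfig d L Circle => ((plaquetteHolonomy U x i j : Circle) : ℂ).re)) := by
  have h := sq_rplaqCharge_mul_le c β x i j
  have hsum : wilsonExpectation u1Rep β (fun U : GaugeConfig d L Circle => ∑ q : Plaquette d L,
      rplaqCharge c q.1 q.2.1.1 q.2.1.2 ^ 2 *
        ((plaquetteHolonomy U q.1 q.2.1.1 q.2.1.2 : Circle) : ℂ).re) =
      (∑ q : Plaquette d L, rplaqCharge c q.1 q.2.1.1 q.2.1.2 ^ 2) *
        wilsonExpectation u1Rep β
          (fun U : GaugeConfig d L Circle => ((plaquetteHolonomy U x i j : Circle) : ℂ).re) := by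
    simp only [wilsonExpectation]
    rw [integral_finsetSum _ fun q _ =>
      (integrable_wilson_of_continuous β (continuous_plaquette_re q.1 q.2.1.1 q.2.1.2)).const_mul _]
    rw [Finset.sum_mul]
    refine Finset.sum_congr rfl fun q _ => ?_
    rw [integral_const_mul]
    congr 1
    exact wilsonExpectation_plaquette_re_eq β q x hij
  rw [hsum, mul_pow] at h
  exact h

end Torus

end Summit.QuantumFields.YangMills.Theorems.U1DipoleHelicity
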